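import Mathlib
import HarnessLib
import Summits.Ventures.LatticeQCDFlow.Exactness.ConnectedGroupKickCovering
import Summits.Ventures.LatticeQCDFlow.Exactness.U1MetropolisLinkErgodic
import Summits.Ventures.LatticeQCDFlow.Exactness.DoeblinAutocovariance

/-!
# The N-hit random-walk Metropolis update of one link of a compact group is Doeblin once its kicks cover

HONEST FRAMING: exact (Metropolis-corrected) sampling algorithms for lattice gauge theory;
figures of merit are autocorrelation/cost numbers at stated couplings and volumes; no
continuum-physics claim.

Venture `LatticeQCDFlow` (cell pub-lqcd), topic `Exactness`, FANOUT row 9 (eng-latcore, the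
engine `latflow.core`: the N-hit link Metropolis `U ← exp(X) U`, accept `min(1, e^{−ΔS})`, of
`updates.sweep_metropolis` / `sun_2d.sweep_metropolis`, the other links frozen).  NEW WORK of the
cell over the tree (`SymmetricMetropolis.lean`: `symMH`, `mulWalk`, `mulWalkMH_invariant`;
`U1MetropolisLinkErgodic.lean` §1: a pinched weight makes `N` hits dominate `(m/M)^N ×` `N`
proposals, on ANY state space; `ConnectedGroupKickCovering.lean`: on a connected compact group some
number of small kicks dominates `δ ·` Haar; `RefreshScan.lean`, `DoeblinUniqueness.lean`).  Nothing
here is cited as a fact.  Printed counterparts, NAMED ONLY: Metropolis et al. 1953; Meyn–Tweedie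
1993 Thm 16.0.2.

The group-generic half of the `SU(2)` Metropolis row of the exactness table (the `U(1)` row is
`U1MetropolisLinkErgodic.lean`, with explicit constants; here the group is any compact
second-countable `G`, the constants are whatever the covering hypothesis provides):

* §1 `gibbsProbability μ p = Z⁻¹ p · μ` on any measurable space; a probability law for a pinched
  weight over a probability `μ` (`isProbabilityMeasure_gibbsProbability`).
* §2 for a probability step law `ν` on `G` whose kicks COVER (`∃ k δ>0 ∀ u, δ • Haar ≤ (mulWalk ν)^k u`
  — `ConnectedGroupKickCovering.exists_nHit_mulWalk_minorised` for a connected `G` and a step law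
  dominating Haar near `1`) and a measurable weight pinched `0 < m ≤ p ≤ M`:
  **`groupLinkMetropolis_nHit_minorised`** — `K^k(u, ·) ≥ (m/M)^k δ · Haar` from EVERY `u`,
  `K = symMH (mulWalk ν) p`; `groupLinkMetropolis_nHit_invariant` — `Z⁻¹ p · Haar` is invariant
  (inversion-invariant `ν`); **`groupLinkMetropolis_nHit_uniformlyErgodic`** — the `k`-hit chain
  converges to `Z⁻¹ p · Haar` geometrically in total variation from every initial law;
  **`groupLinkMetropolis_invariant_unique`** — `Z⁻¹ p · Haar` is the only probability law invariant
  under ONE hit.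

For the engine: `p = exp(β/N · Re tr(U R†))` (the conditional Wilson weight of the link given its
staple sum `R`) is continuous on the compact group, hence pinched; the `SU(2)` kick law of
`sweep_metropolis` dominates Lebesgue-through-the-chart near `1` (`SU2MetropolisKickCovering.lean`).
NOT CLAIMED: any rate; the sweep over links at a fixed `nhit` (needs kicks of one link accumulated
across sweeps); `SU(N ≥ 3)` coverage of the engine's kick (no chart density in the tree).
-/

noncomputable section

namespace Summit.Ventures.LatticeQCDFlow.Exactness

open MeasureTheory ProbabilityTheory Set Filter Topology Function
open Literature.MathematicalPhysics.QuantumFieldTheory (haarProbability)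
open scoped ENNReal

/-! ## §1 The normalised Gibbs law of a weight -/

section Gibbs

variable {Ω : Type*} [MeasurableSpace Ω]

/-- The normalised Gibbs law `Z⁻¹ p · μ` of a real weight `p` over a reference measure `μ`. -/
def gibbsProbability (μ : Measure Ω) (p : Ω → ℝ) : Measure Ω :=
  ((μ.withDensity fun x => ENNReal.ofReal (p x)) univ)⁻¹ • μ.withDensity fun x => ENNReal.ofReal (p x)

variable {μ : Measure Ω} [IsProbabilityMeasure μ] {p : Ω → ℝ} {m M : ℝ}

/-- The partition function of a pinched weight over a probability measure is in `(0, ∞)`. -/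
theorem gibbs_partition_ne (hm : 0 < m) (hpm : ∀ x, m ≤ p x) (hpM : ∀ x, p x ≤ M) :
    (μ.withDensity fun x => ENNReal.ofReal (p x)) univ ≠ 0 ∧
      (μ.withDensity fun x => ENNReal.ofReal (p x)) univ ≠ ⊤ := by
  rw [withDensity_apply _ MeasurableSet.univ, Measure.restrict_univ]
  constructor
  · intro h0
    have hle : ∫⁻ _x : Ω, ENNReal.ofReal m ∂μ ≤ 0 := by
      rw [← h0]
      exact lintegral_mono fun x => ENNReal.ofReal_le_ofReal (hpm x)
    rw [MeasureTheory.lintegral_const, measure_univ, mul_one, nonpos_iff_eq_zero, ENNReal.ofReal_eq_zero] at hle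
    exact absurd hle (not_le.2 hm)
  · refine ne_top_of_le_ne_top (ENNReal.ofReal_ne_top (r := M)) ?_
    calc ∫⁻ x, ENNReal.ofReal (p x) ∂μ ≤ ∫⁻ _x, ENNReal.ofReal M ∂μ :=
          lintegral_mono fun x => ENNReal.ofReal_le_ofReal (hpM x)
      _ = ENNReal.ofReal M := by rw [MeasureTheory.lintegral_const, measure_univ, mul_one]

/-- `Z⁻¹ p · μ` is a probability law for a pinched weight over a probability measure. -/
theorem isProbabilityMeasure_gibbsProbability (hm : 0 < m) (hpm : ∀ x, m ≤ p x) (hpM : ∀ x, p x ≤ M) :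
    IsProbabilityMeasure (gibbsProbability μ p) := by
  have hZ := gibbs_partition_ne (μ := μ) hm hpm hpM
  exact ⟨by rw [gibbsProbability, Measure.smul_apply, smul_eq_mul, ENNReal.inv_mul_cancel hZ.1 hZ.2]⟩

omit [IsProbabilityMeasure μ] in
/-- A kernel leaving `p · μ` invariant leaves `Z⁻¹ p · μ` invariant. -/
theorem invariant_gibbsProbability {κ : Kernel Ω Ω}
    (h : Kernel.Invariant κ (μ.withDensity fun x => ENNReal.ofReal (p x))) :
    Kernel.Invariant κ (gibbsProbability μ p) :=
  invariant_smul h _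

end Gibbs

/-! ## §2 The N-hit link Metropolis on a compact group whose kicks cover -/

section Link

variable {G : Type*} [TopologicalSpace G] [Group G] [IsTopologicalGroup G] [CompactSpace G]
  [MeasurableSpace G] [BorelSpace G] [SecondCountableTopology G]
variable {ν : Measure G} [IsProbabilityMeasure ν] {p : G → ℝ} {m M : ℝ} {k : ℕ} {δ : ℝ≥0∞}

/-- **DOEBLIN AFTER `k` HITS, UNIFORMLY IN THE ENVIRONMENT.**  If `k` kicks of the step law `ν`
dominate `δ ·` Haar from every start and the measurable weight is pinched `0 < m ≤ p ≤ M`, then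
`(K^k)(u, ·) ≥ (m/M)^k δ · Haar` from EVERY `u ∈ G`, `K = symMH (mulWalk ν) p`. -/
theorem groupLinkMetropolis_nHit_minorised (hcov : ∀ u : G, δ • haarProbability G ≤ nHit (mulWalk ν) k u)
    (hp : Measurable p) (hm : 0 < m) (hpm : ∀ x, m ≤ p x) (hpM : ∀ x, p x ≤ M) (u : G) :
    (ENNReal.ofReal (m / M) ^ k * δ) • haarProbability G ≤ nHit (symMH (mulWalk ν) p) k u :=
  calc (ENNReal.ofReal (m / M) ^ k * δ) • haarProbability G
      = ENNReal.ofReal (m / M) ^ k • (δ • haarProbability G) := by rw [mul_smul]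
    _ ≤ ENNReal.ofReal (m / M) ^ k • nHit (mulWalk ν) k u := measure_smul_le_smul_of_le (hcov u) _
    _ ≤ nHit (symMH (mulWalk ν) p) k u := smul_nHit_le_nHit_symMH hp hm hpm hpM k u

omit [TopologicalSpace G] [IsTopologicalGroup G] [CompactSpace G] [MeasurableSpace G] [BorelSpace G]
  [SecondCountableTopology G] in
/-- The Doeblin constant is positive when `δ` is. -/
theorem groupLinkMetropolis_const_pos (hδ : 0 < δ) (hm : 0 < m) (hpm : ∀ x, m ≤ p x) (hpM : ∀ x, p x ≤ M) :
    0 < ENNReal.ofReal (m / M) ^ k * δ := by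
  have hM : 0 < M := hm.trans_le ((hpm 1).trans (hpM 1))
  have hmM : ENNReal.ofReal (m / M) ≠ 0 := by
    rw [Ne, ENNReal.ofReal_eq_zero, not_le]; exact div_pos hm hM
  exact ENNReal.mul_pos (pow_ne_zero _ hmM) hδ.ne'

/-- One hit — hence `n` hits — leaves `Z⁻¹ p · Haar` invariant (`mulWalkMH_invariant`: left-invariant
Haar, inversion-invariant probability step law, positive measurable weight). -/
theorem groupLinkMetropolis_nHit_invariant [ν.IsInvInvariant] (hp : Measurable p) (hp0 : ∀ u, 0 < p u)
    (n : ℕ) : Kernel.Invariant (nHit (symMH (mulWalk ν) p) n) (gibbsProbability (haarProbability G) p) :=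
  invariant_gibbsProbability (invariant_nHit (mulWalkMH_invariant (μ := haarProbability G) hp hp0) n)

omit [CompactSpace G] in
/-- Powers of the link Metropolis kernel are Markov. -/
theorem isMarkovKernel_nHit_symMH_mulWalk (hp : Measurable p) (n : ℕ) :
    IsMarkovKernel (nHit (symMH (mulWalk ν) p) n) := by
  haveI : Fact (Measurable p) := ⟨hp⟩
  exact isMarkovKernel_nHit _ n

/-- **THE `k`-HIT LINK METROPOLIS IS UNIFORMLY ERGODIC** once `k` kicks cover: for an
inversion-invariant probability step law `ν` with `(mulWalk ν)^k(u, ·) ≥ δ · Haar` (`δ > 0`) and a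
measurable weight pinched `0 < m ≤ p ≤ M`,
`|μ₀(K^k)ᵗ(A) − (Z⁻¹p·Haar)(A)| ≤ (1 − (m/M)^k δ)ᵗ` for every initial law `μ₀`, every `t`, every `A`. -/
theorem groupLinkMetropolis_nHit_uniformlyErgodic [ν.IsInvInvariant]
    (hcov : ∀ u : G, δ • haarProbability G ≤ nHit (mulWalk ν) k u)
    (hp : Measurable p) (hm : 0 < m) (hpm : ∀ x, m ≤ p x) (hpM : ∀ x, p x ≤ M)
    (μ₀ : Measure G) [IsProbabilityMeasure μ₀] (t : ℕ) (A : Set G) :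
    |((fun m' : Measure G => m'.bind (nHit (symMH (mulWalk ν) p) k))^[t] μ₀).real A
        - (gibbsProbability (haarProbability G) p).real A| ≤
      (1 - (ENNReal.ofReal (m / M) ^ k * δ).toReal) ^ t := by
  haveI := isProbabilityMeasure_gibbsProbability (μ := haarProbability G) hm hpm hpM
  haveI := isMarkovKernel_nHit_symMH_mulWalk (ν := ν) hp k
  have hp0 : ∀ u, 0 < p u := fun u => hm.trans_le (hpm u)
  exact uniformlyErgodic_of_minorised (groupLinkMetropolis_nHit_minorised hcov hp hm hpm hpM)
    (groupLinkMetropolis_nHit_invariant hp hp0 k) μ₀ t A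

/-- **`Z⁻¹ p · Haar` is the only probability law invariant under ONE hit** of the link Metropolis
(an invariant law of `K` is invariant under `K^k`, which is Doeblin). -/
theorem groupLinkMetropolis_invariant_unique [ν.IsInvInvariant]
    (hcov : ∀ u : G, δ • haarProbability G ≤ nHit (mulWalk ν) k u) (hδ : 0 < δ)
    (hp : Measurable p) (hm : 0 < m) (hpm : ∀ x, m ≤ p x) (hpM : ∀ x, p x ≤ M)
    {π' : Measure G} [IsProbabilityMeasure π'] (hπ' : Kernel.Invariant (symMH (mulWalk ν) p) π') :
    π' = gibbsProbability (haarProbability G) p := by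
  haveI := isProbabilityMeasure_gibbsProbability (μ := haarProbability G) hm hpm hpM
  haveI := isMarkovKernel_nHit_symMH_mulWalk (ν := ν) hp k
  have hp0 : ∀ u, 0 < p u := fun u => hm.trans_le (hpm u)
  exact invariant_unique_of_minorised (groupLinkMetropolis_nHit_minorised hcov hp hm hpm hpM)
    (groupLinkMetropolis_const_pos hδ hm hpm hpM) (groupLinkMetropolis_nHit_invariant hp hp0 k)
    (invariant_nHit hπ' k)

/-- **CONNECTED GROUPS: A STEP LAW DOMINATING HAAR NEAR THE IDENTITY SUFFICES.**  On a connected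
compact group, for an inversion-invariant probability step law `ν ≥ c · Haar|_V` (`V` a
neighbourhood of `1`, `c ≠ 0`) and a measurable weight pinched `0 < m ≤ p ≤ M`, there are `k` and
`ε > 0` such that the `k`-hit link Metropolis chain converges to `Z⁻¹ p · Haar` at rate `(1 − ε)ᵗ`
from every initial law, and `Z⁻¹ p · Haar` is its unique invariant probability law. -/
theorem groupLinkMetropolis_uniformlyErgodic_of_nhds [ConnectedSpace G] [ν.IsInvInvariant] {V : Set G}
    (hV : V ∈ 𝓝 (1 : G)) {c : ℝ≥0∞} (hc : c ≠ 0) (hν : c • (haarProbability G).restrict V ≤ ν)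
    (hp : Measurable p) (hm : 0 < m) (hpm : ∀ x, m ≤ p x) (hpM : ∀ x, p x ≤ M) :
    ∃ k : ℕ, ∃ ε : ℝ, 0 < ε ∧ ε ≤ 1 ∧
      (∀ (μ₀ : Measure G) [IsProbabilityMeasure μ₀] (t : ℕ) (A : Set G),
        |((fun m' : Measure G => m'.bind (nHit (symMH (mulWalk ν) p) k))^[t] μ₀).real A
            - (gibbsProbability (haarProbability G) p).real A| ≤ (1 - ε) ^ t) ∧
      ∀ (π' : Measure G) [IsProbabilityMeasure π'], Kernel.Invariant (symMH (mulWalk ν) p) π' →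
        π' = gibbsProbability (haarProbability G) p := by
  obtain ⟨k, δ, hδ, hcov⟩ := exists_nHit_mulWalk_minorised hV hc hν
  haveI := isMarkovKernel_nHit_symMH_mulWalk (ν := ν) hp k
  set ε : ℝ≥0∞ := ENNReal.ofReal (m / M) ^ k * δ
  have hε0 : 0 < ε := groupLinkMetropolis_const_pos hδ hm hpm hpM
  have hε1 : ε ≤ 1 := by
    have h := Measure.le_iff'.1 (groupLinkMetropolis_nHit_minorised hcov hp hm hpm hpM 1) univ
    rwa [Measure.smul_apply, smul_eq_mul, measure_univ, measure_univ, mul_one] at h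
  have hεtop : ε ≠ ⊤ := ne_top_of_le_ne_top ENNReal.one_ne_top hε1
  refine ⟨k, ε.toReal, ENNReal.toReal_pos hε0.ne' hεtop,
    ENNReal.toReal_le_of_le_ofReal zero_le_one (by rwa [ENNReal.ofReal_one]), fun μ₀ _ t A => ?_,
    fun π' _ hπ' => ?_⟩
  · exact groupLinkMetropolis_nHit_uniformlyErgodic hcov hp hm hpm hpM μ₀ t A
  · exact groupLinkMetropolis_invariant_unique hcov hδ hp hm hpm hpM hπ'

end Link

end Summit.Ventures.LatticeQCDFlow.Exactness
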